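import Summits.ValiantsHypothesis.ValiantsHypothesis.Theorems.SymPencilPerFourToricLowRank
import Summits.ValiantsHypothesis.ValiantsHypothesis.Theorems.SymPencilPerFourToricTwoRow

/-!
# Route `SymPencil` — the toric case at dimension `6`, V: the profile `(2,2,2,1)`
# (`--supports` stmt-ValiantsHypothesis-5674 `SdcSuperquadratic`; crux workfile
# `Cruxes/SdcSuperquadratic/TORIC-SIX.md`)

Setting: `W` a `6`-dimensional space of `4 × 4` matrices with H3 and all row and column ranks
`≤ 2`.

**Theorem** (`false_of_row_rank_le_one`).  No row of `W` has rank `≤ 1`.  (With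
`SymPencilPerFourToricZeroRow` / `SymPencilPerFourToricLowRank` this leaves only the profile
`(2,2,2,2)` for the toric case of `R6`.)

Proof.  Two low rows are `SymPencilPerFourToricLowRank.false_of_two_rows_rank_le_one`; so row
`q` has rank `1`, `L_q = K v`, and the three other rows have rank `2`.  For a row `c ≠ q` with
`v ∉ L_c` the pair lever (`SymPencilPerFourToricLever`) on the two remaining rows `a, b` has the
`3`-dimensional kernel `L_c + K v`, so all `2 × 2` subpermanents of the pair space `W ∩ {rows c, q
= 0}` (dimension `≥ 6 - 2 - 1 = 3`) vanish — contradicting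
`SymPencilPerFourToricTwoRow.finrank_le_two_of_perms_vanish`.  Hence `v ∈ L_a ∩ L_b ∩ L_c`; for a
column `j` in the support of `v` the elements of `W` with row `q` zero (dimension `5`) have at most
a `3`-dimensional subspace with column `j` zero (one dimension per row), so their column-`j` image
has dimension `≥ 2`, and together with `v_j ≠ 0` in row `q` the column `j` has rank `3`.

Honest framing: one profile of the toric case of `R6`; nothing here changes `sdc(per_4) ≥ 25`; the
crux `SdcSuperquadratic` and `VP ≠ VNP` are untouched.  No definitions, no named facts. [folklore]
-/

noncomputable section

-- single-conjunct layout: Sub = Summit, duplicated namespace component intended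
set_option linter.dupNamespace false

namespace Summit.ValiantsHypothesis.ValiantsHypothesis.Theorems.SymPencilPerFourToricOneLow

open Matrix Finset Module
open Literature.Computability.AlgebraicComplexity
open Literature.Computability.AlgebraicComplexity.AlperBogartVelasco
open Summit.ValiantsHypothesis.ValiantsHypothesis.Theorems.SymPencilPerFourHessianRankThreeZero
open Summit.ValiantsHypothesis.ValiantsHypothesis.Theorems.SymPencilPerFourHessianToric
open Summit.ValiantsHypothesis.ValiantsHypothesis.Theorems.SymPencilPerFourToricLever
open Summit.ValiantsHypothesis.ValiantsHypothesis.Theorems.SymPencilPerFourToricZeroRow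
open Summit.ValiantsHypothesis.ValiantsHypothesis.Theorems.SymPencilPerFourToricLowRank
open Summit.ValiantsHypothesis.ValiantsHypothesis.Theorems.SymPencilPerFourToricTwoRow

variable {K : Type*} [Field K]

/-- A row of rank `≤ 2` which is live at column `j` has at most a line of values vanishing at `j`.
[folklore] -/
theorem finrank_row_inf_ker_le_one (W : Submodule K (Fin 4 × Fin 4 → K)) (p j : Fin 4)
    (hp : finrank K (W.map (LinearMap.funLeft K K fun j : Fin 4 => (p, j))) ≤ 2)
    (hlive : ∃ x ∈ W, x (p, j) ≠ 0) :
    finrank K ↥(W.map (LinearMap.funLeft K K fun j : Fin 4 => (p, j)) ⊓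
      LinearMap.ker (LinearMap.proj j : (Fin 4 → K) →ₗ[K] K)) ≤ 1 := by
  set L := W.map (LinearMap.funLeft K K fun j : Fin 4 => (p, j)) with hL
  have h := finrank_eq_finrank_map_add_finrank_inf_ker L (LinearMap.proj j : (Fin 4 → K) →ₗ[K] K)
  have hpos : 1 ≤ finrank K (L.map (LinearMap.proj j : (Fin 4 → K) →ₗ[K] K)) := by
    obtain ⟨x, hx, hxj⟩ := hlive
    rw [Nat.one_le_iff_ne_zero, Ne, Submodule.finrank_eq_zero, Submodule.eq_bot_iff]
    intro h0
    apply hxj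
    have hm : (x (p, j) : K) ∈ L.map (LinearMap.proj j : (Fin 4 → K) →ₗ[K] K) :=
      ⟨_, ⟨x, hx, rfl⟩, rfl⟩
    exact h0 _ hm
  omega

set_option maxHeartbeats 800000 in
/-- For a row `c ≠ q` (row `q` of rank `≤ 1`, row `c` of rank `2`): every row-`q` value lies in
`L_c`. [folklore] -/
theorem row_mem_of_rank_le_one [CharZero K] (W : Submodule K (Fin 4 × Fin 4 → K))
    (hW3 : ∀ x ∈ W, ∀ (r c : Fin 3 → Fin 4), Function.Injective r → Function.Injective c →
      ((Matrix.of fun i j => x (i, j)).submatrix r c).permanent = 0)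
    (hrow : ∀ r : Fin 4, finrank K (W.map (LinearMap.funLeft K K fun j : Fin 4 => (r, j))) ≤ 2)
    (h6 : finrank K W = 6) (a b c q : Fin 4) (hab : a ≠ b) (hac : a ≠ c) (haq : a ≠ q)
    (hbc : b ≠ c) (hbq : b ≠ q) (hcq : c ≠ q)
    (hq : finrank K (W.map (LinearMap.funLeft K K fun j : Fin 4 => (q, j))) ≤ 1)
    (hc2 : finrank K (W.map (LinearMap.funLeft K K fun j : Fin 4 => (c, j))) = 2) :
    ∀ y ∈ W, (LinearMap.funLeft K K fun j : Fin 4 => (q, j)) y ∈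
      W.map (LinearMap.funLeft K K fun j : Fin 4 => (c, j)) := by
  classical
  intro y hy
  set ρa := (LinearMap.funLeft K K fun j : Fin 4 => (a, j)) with hρa
  set ρb := (LinearMap.funLeft K K fun j : Fin 4 => (b, j)) with hρb
  set ρc := (LinearMap.funLeft K K fun j : Fin 4 => (c, j)) with hρc
  set ρq := (LinearMap.funLeft K K fun j : Fin 4 => (q, j)) with hρq
  have eρa : ∀ (x : Fin 4 × Fin 4 → K) (j : Fin 4), ρa x j = x (a, j) := fun _ _ => rfl
  have eρb : ∀ (x : Fin 4 × Fin 4 → K) (j : Fin 4), ρb x j = x (b, j) := fun _ _ => rfl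
  have eρc : ∀ (x : Fin 4 × Fin 4 → K) (j : Fin 4), ρc x j = x (c, j) := fun _ _ => rfl
  have eρq : ∀ (x : Fin 4 × Fin 4 → K) (j : Fin 4), ρq x j = x (q, j) := fun _ _ => rfl
  have hra : finrank K (W.map ρa) ≤ 2 := hrow a
  have hrb : finrank K (W.map ρb) ≤ 2 := hrow b
  by_contra hnot
  have hv0 : ρq y ≠ 0 := fun h => hnot (by rw [h]; exact Submodule.zero_mem _)
  -- `M = L_c + K v` has dimension `3`
  set M : Submodule K (Fin 4 → K) := W.map ρc ⊔ K ∙ (ρq y) with hM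
  have hM3 : 3 ≤ finrank K M := by
    have hinf : W.map ρc ⊓ (K ∙ ρq y) = ⊥ := by
      rw [Submodule.eq_bot_iff]
      intro v hv
      obtain ⟨hv1, hv2⟩ := Submodule.mem_inf.1 hv
      rw [Submodule.mem_span_singleton] at hv2
      obtain ⟨k, rfl⟩ := hv2
      by_cases hk : k = 0
      · rw [hk, zero_smul]
      · exfalso; apply hnot
        have := Submodule.smul_mem (W.map ρc) k⁻¹ hv1
        rwa [smul_smul, inv_mul_cancel₀ hk, one_smul] at this
    have h := Submodule.finrank_sup_add_finrank_inf_eq (W.map ρc) (K ∙ ρq y)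
    rw [hinf, finrank_bot, add_zero, finrank_span_singleton hv0] at h
    rw [hM]; omega
  -- the pair space `X = W ∩ {rows c, q = 0}` has dimension `≥ 3`
  set X := W ⊓ LinearMap.ker ρc ⊓ LinearMap.ker ρq with hX
  have hX3 : 3 ≤ finrank K X := by
    have d : finrank K W ≤ finrank K X + finrank K (W.map ρc) + finrank K (W.map ρq) :=
      finrank_pair_le W c q
    omega
  have memX : ∀ x, x ∈ X ↔ x ∈ W ∧ (∀ j, x (c, j) = 0) ∧ ∀ j, x (q, j) = 0 := fun x => by
    rw [hX]; exact mem_pair_iff W c q x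
  -- all `2 × 2` subpermanents of rows `a, b` vanish on `X`
  have hP : ∀ x ∈ X, ∀ l l' : Fin 4, l ≠ l' →
      x (a, l) * x (b, l') + x (a, l') * x (b, l) = 0 := by
    intro x hx
    obtain ⟨hxW, hxc, hxq⟩ := (memX x).1 hx
    refine perms_vanish_of_lever_three M hM3 x a b fun u hu j₀ j₁ j₂ h01 h02 h12 => ?_
    rw [hM, Submodule.mem_sup] at hu
    obtain ⟨u₁, hu₁, u₂, hu₂, rfl⟩ := hu
    obtain ⟨y₁, hy₁, rfl⟩ := hu₁
    rw [Submodule.mem_span_singleton] at hu₂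
    obtain ⟨k, rfl⟩ := hu₂
    have e1 := pair_lever W hW3 hxW hy₁ hab hac hbc hxc h01 h02 h12
    have e2 := pair_lever W hW3 hxW hy hab haq hbq hxq h01 h02 h12
    simp only [Pi.add_apply, Pi.smul_apply, smul_eq_mul, eρc, eρq]
    linear_combination e1 + k * e2
  -- hence `dim X ≤ 2`: contradiction
  have hXrows : ∀ x ∈ X, ∀ i j : Fin 4, i ≠ a → i ≠ b → x (i, j) = 0 := by
    intro x hx i j hia hib
    obtain ⟨-, hxc, hxq⟩ := (memX x).1 hx
    rcases eq_or_of_four a b c q hab hac haq hbc hbq hcq i with hi | hi | hi | hi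
    · exact absurd hi hia
    · exact absurd hi hib
    · rw [hi]; exact hxc j
    · rw [hi]; exact hxq j
  have hXW : X ≤ W := inf_le_left.trans inf_le_left
  have h2 := finrank_le_two_of_perms_vanish X a b hXrows hP
    ((Submodule.finrank_mono (Submodule.map_mono hXW)).trans hra)
    ((Submodule.finrank_mono (Submodule.map_mono hXW)).trans hrb)
  omega

set_option maxHeartbeats 800000 in
/-- **No toric `6`-dimensional singular subspace has a row of rank `≤ 1`.**  See the module
docstring. [folklore] -/
theorem false_of_row_rank_le_one [CharZero K] (W : Submodule K (Fin 4 × Fin 4 → K))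
    (hW3 : ∀ x ∈ W, ∀ (r c : Fin 3 → Fin 4), Function.Injective r → Function.Injective c →
      ((Matrix.of fun i j => x (i, j)).submatrix r c).permanent = 0)
    (hrow : ∀ r : Fin 4, finrank K (W.map (LinearMap.funLeft K K fun j : Fin 4 => (r, j))) ≤ 2)
    (hcol : ∀ l : Fin 4, finrank K (W.map (LinearMap.funLeft K K fun i : Fin 4 => (i, l))) ≤ 2)
    (h6 : finrank K W = 6) (q : Fin 4)
    (hq : finrank K (W.map (LinearMap.funLeft K K fun j : Fin 4 => (q, j))) ≤ 1) : False := by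
  classical
  -- two low rows are excluded
  by_cases h2 : ∃ r, r ≠ q ∧ finrank K (W.map (LinearMap.funLeft K K fun j : Fin 4 => (r, j))) ≤ 1
  · obtain ⟨r, hrq, hr⟩ := h2
    exact false_of_two_rows_rank_le_one W hW3 hrow hcol h6 q r (Ne.symm hrq) hq hr
  push Not at h2
  have hn2 : ∀ r, r ≠ q → finrank K (W.map (LinearMap.funLeft K K fun j : Fin 4 => (r, j))) = 2 :=
    fun r hr => by have := h2 r hr; have := hrow r; omega
  have eρ : ∀ (r : Fin 4) (x : Fin 4 × Fin 4 → K) (j : Fin 4),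
      (LinearMap.funLeft K K fun j : Fin 4 => (r, j)) x j = x (r, j) := fun _ _ _ => rfl
  have eγ : ∀ (l : Fin 4) (x : Fin 4 × Fin 4 → K) (i : Fin 4),
      (LinearMap.funLeft K K fun i : Fin 4 => (i, l)) x i = x (i, l) := fun _ _ _ => rfl
  -- row `q` is not zero: a live cell `(q, j)`
  obtain ⟨x₀, hx₀, j, hj⟩ : ∃ x₀ ∈ W, ∃ j, x₀ (q, j) ≠ 0 := by
    by_contra h
    push Not at h
    exact false_of_zero_row W hW3 hrow hcol h6 q h
  -- the three other rows, all containing `v = ρ_q x₀`; so they are live at `j`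
  obtain ⟨a, b, c, hab, hac, hbc, haq, hbq, hcq, hrows⟩ := exists_three_others q
  have hlive : ∀ p, p ≠ q → ∃ x ∈ W, x (p, j) ≠ 0 := by
    intro p hpq
    obtain ⟨r', r'', hr'r'', hr'q, hr'p, hr''q, hr''p, -⟩ := exists_other_two q p (Ne.symm hpq)
    obtain ⟨x, hx, hxv⟩ := row_mem_of_rank_le_one W hW3 hrow h6 r' r'' p q hr'r'' hr'p hr'q
      hr''p hr''q hpq hq (hn2 p hpq) x₀ hx₀
    refine ⟨x, hx, ?_⟩
    have := congr_fun hxv j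
    rw [eρ, eρ] at this
    rw [this]; exact hj
  -- `W' = W ∩ {row q = 0}` has dimension `≥ 5`
  set ρq := (LinearMap.funLeft K K fun j : Fin 4 => (q, j)) with hρq
  set γ := (LinearMap.funLeft K K fun i : Fin 4 => (i, j)) with hγdef
  have eγ' : ∀ (x : Fin 4 × Fin 4 → K) (i : Fin 4), γ x i = x (i, j) := fun _ _ => rfl
  set W' := W ⊓ LinearMap.ker ρq with hW'
  have hW'5 : 5 ≤ finrank K W' := by
    have := finrank_eq_finrank_map_add_finrank_inf_ker W ρq
    rw [← hW'] at this
    omega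
  -- `Y = W' ∩ {column j = 0}` has dimension `≤ 3`
  set Y := W' ⊓ LinearMap.ker γ with hY
  have memY : ∀ x, x ∈ Y → x ∈ W ∧ (∀ l, x (q, l) = 0) ∧ ∀ i, x (i, j) = 0 := by
    intro x hx
    rw [hY, hW', Submodule.mem_inf, Submodule.mem_inf, LinearMap.mem_ker, LinearMap.mem_ker] at hx
    exact ⟨hx.1.1, fun l => congr_fun hx.1.2 l, fun i => congr_fun hx.2 i⟩
  -- one dimension per row
  have step : ∀ (p : Fin 4) (Z : Submodule K (Fin 4 × Fin 4 → K)), p ≠ q → Z ≤ Y →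
      finrank K Z ≤ 1 + finrank K ↥(Z ⊓ LinearMap.ker (LinearMap.funLeft K K fun j : Fin 4 => (p, j))) := by
    intro p Z hpq hZY
    have h := finrank_eq_finrank_map_add_finrank_inf_ker Z (LinearMap.funLeft K K fun j : Fin 4 => (p, j))
    have hle : Z.map (LinearMap.funLeft K K fun j : Fin 4 => (p, j)) ≤
        W.map (LinearMap.funLeft K K fun j : Fin 4 => (p, j)) ⊓
          LinearMap.ker (LinearMap.proj j : (Fin 4 → K) →ₗ[K] K) := by
      rintro _ ⟨x, hx, rfl⟩
      obtain ⟨hxW, -, hxj⟩ := memY x (hZY hx)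
      refine Submodule.mem_inf.2 ⟨⟨x, hxW, rfl⟩, ?_⟩
      rw [LinearMap.mem_ker, LinearMap.proj_apply, eρ]
      exact hxj p
    have := (Submodule.finrank_mono hle).trans (finrank_row_inf_ker_le_one W p j (hrow p) (hlive p hpq))
    omega
  have hY3 : finrank K Y ≤ 3 := by
    have s1 := step a Y haq le_rfl
    set Y₁ := Y ⊓ LinearMap.ker (LinearMap.funLeft K K fun j : Fin 4 => (a, j)) with hY₁
    have s2 := step b Y₁ hbq inf_le_left
    set Y₂ := Y₁ ⊓ LinearMap.ker (LinearMap.funLeft K K fun j : Fin 4 => (b, j)) with hY₂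
    have s3 := step c Y₂ hcq (inf_le_left.trans inf_le_left)
    set Y₃ := Y₂ ⊓ LinearMap.ker (LinearMap.funLeft K K fun j : Fin 4 => (c, j)) with hY₃
    have h0 : finrank K Y₃ = 0 := by
      rw [Submodule.finrank_eq_zero, Submodule.eq_bot_iff]
      intro x hx
      rw [hY₃, Submodule.mem_inf, LinearMap.mem_ker] at hx
      obtain ⟨hx2, hxc⟩ := hx
      rw [hY₂, Submodule.mem_inf, LinearMap.mem_ker] at hx2
      obtain ⟨hx1, hxb⟩ := hx2
      rw [hY₁, Submodule.mem_inf, LinearMap.mem_ker] at hx1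
      obtain ⟨hx0, hxa⟩ := hx1
      obtain ⟨-, hxq, -⟩ := memY x hx0
      funext e; obtain ⟨i, l⟩ := e
      rcases hrows i with hi | hi | hi | hi <;> rw [hi]
      · exact hxq l
      · have := congr_fun hxa l; rwa [eρ] at this
      · have := congr_fun hxb l; rwa [eρ] at this
      · have := congr_fun hxc l; rwa [eρ] at this
    omega
  -- so the column-`j` image of `W'` has dimension `≥ 2`, and misses `γ x₀`
  have hW'j : 2 ≤ finrank K (W'.map γ) := by
    have := finrank_eq_finrank_map_add_finrank_inf_ker W' γ
    rw [← hY] at this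
    omega
  have hnot : γ x₀ ∉ W'.map γ := by
    intro hmem
    rw [Submodule.mem_map] at hmem
    obtain ⟨x, hx, hxx⟩ := hmem
    rw [hW', Submodule.mem_inf, LinearMap.mem_ker] at hx
    have h1 := congr_fun hxx q
    rw [eγ', eγ'] at h1
    have h2 := congr_fun hx.2 j
    rw [eρ] at h2
    exact hj (by rw [← h1]; exact h2)
  have hγ0 : γ x₀ ≠ 0 := fun h => hnot (by rw [h]; exact Submodule.zero_mem _)
  have hinf : W'.map γ ⊓ (K ∙ γ x₀) = ⊥ := by
    rw [Submodule.eq_bot_iff]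
    intro v hv
    obtain ⟨hv1, hv2⟩ := Submodule.mem_inf.1 hv
    rw [Submodule.mem_span_singleton] at hv2
    obtain ⟨k, rfl⟩ := hv2
    by_cases hk : k = 0
    · rw [hk, zero_smul]
    · exfalso; apply hnot
      have := Submodule.smul_mem (W'.map γ) k⁻¹ hv1
      rwa [smul_smul, inv_mul_cancel₀ hk, one_smul] at this
  have hsup := Submodule.finrank_sup_add_finrank_inf_eq (W'.map γ) (K ∙ γ x₀)
  rw [hinf, finrank_bot, add_zero, finrank_span_singleton hγ0] at hsup
  have hle : W'.map γ ⊔ (K ∙ γ x₀) ≤ W.map γ :=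
    sup_le (Submodule.map_mono inf_le_left)
      ((Submodule.span_singleton_le_iff_mem _ _).2 ⟨x₀, hx₀, rfl⟩)
  have := Submodule.finrank_mono hle
  have hcj : finrank K (W.map γ) ≤ 2 := hcol j
  omega

end Summit.ValiantsHypothesis.ValiantsHypothesis.Theorems.SymPencilPerFourToricOneLow

end
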